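import Mathlib.RingTheory.Ideal.Height
import Mathlib.RingTheory.Ideal.KrullsHeightTheorem
import Mathlib.RingTheory.Localization.AtPrime.Basic
import Mathlib.RingTheory.Localization.Away.Basic
import Mathlib.RingTheory.Localization.Submodule
import HarnessLib

/-!
# Route `RadicialJung`, crux `CleanModels` (stmt-15917): shrinking an affine chart so that a local prime divisor
# becomes a GLOBAL prime principal divisor — piece (S1c) of `HOME/L/res-L0-w81-pv-2/g5/S1-SPEC.md`

Support file (OURS) for PROGRAMME-clean-dim2 / T2 (`HOME/L/res-L0-w81-pv-2/g5/T2-ARCHITECTURE.md`, brick **B3**, step (S1):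
the chart construction that makes `stub_finite_singular` unconditional); seat res-D-pv-036 g11 (res-plan-2 IDLE POOL DEAL
#65 (4)); spec (S1c) «PURE CA» of res-L0-w81-pv-2 g5 (S1-SPEC fa4129896e2cdcc3); line `via-clean-models` of the crux
`DescentPerfectToAll` (stmt-0549). Nothing here is a statement of Hironaka's manuscript. AI-written; AI review weaker than
expert review. Theses-free, definition-free.

THE STATEMENT (`exists_away_span_singleton_isPrime_of_isLocalization`). Let `A` be a Noetherian domain, `x ≠ 0`, `𝔮₀` a
prime of `A` such that `x·A_{𝔮₀}` is a prime ideal of the local ring `A_{𝔮₀}`. Then there is `e ∉ 𝔮₀` such that for EVERY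
localization `A'` of `A` at a submonoid `M ∋ e` with `M ∩ 𝔮₀ = ∅` (every further shrinking of the basic open `D(e)` around
the point `𝔮₀`), `x·A'` is a prime ideal of height one. Corollary `exists_away_span_singleton_isPrime`: the same for
`A' = A[1/e]` (`Localization.Away e`).

PROOF (no regularity or normality is needed — the spec's minimal-prime route is replaced by a finite-generation argument).
Let `𝔭 := (x·A_{𝔮₀}) ∩ A`, a prime with `x ∈ 𝔭 ⊆ 𝔮₀`. It is finitely generated, `𝔭 = (g₁, …, g_m)`; each `g_i/1 ∈ x·A_{𝔮₀}`,
so `s_i g_i ∈ (x)` for some `s_i ∉ 𝔮₀`. Put `e := ∏ s_i ∉ 𝔮₀`. In any `A'` as above every `s_i` is a unit (it divides the unit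
`e`), hence `g_i ∈ x·A'` and `𝔭·A' ⊆ x·A' ⊆ 𝔭·A'`: so `x·A' = 𝔭·A'`, which is prime because `M ∩ 𝔭 ⊆ M ∩ 𝔮₀ = ∅`
(`IsLocalization.isPrime_of_isPrime_disjoint`). Height one: `A'` is a Noetherian domain, `x ≠ 0` in it and `x` is not a unit
(`x·A'` is prime), so Krull's principal ideal theorem gives `ht (x·A') = 1`
(`Ideal.height_span_singleton_eq_one_of_mem_nonZeroDivisors`). [cite: Matsumura1987, Thm. 4.1, Thm. 13.5] [folklore]
-/

noncomputable section

set_option linter.dupNamespace false -- mandated namespace of this single-conjunct summit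

namespace Summit.ResolutionOfSingularities.ResolutionOfSingularities.Theorems.RadicialJung.CleanModels

universe u v

variable {A : Type u} [CommRing A] [IsDomain A] [IsNoetherianRing A]

/-- **Shrinking the chart: a local prime principal divisor is a global one on a basic open neighbourhood — robust form.**
`A` a Noetherian domain, `x ≠ 0`, `𝔮₀` prime with `x·A_{𝔮₀}` prime ⇒ `∃ e ∉ 𝔮₀` such that `x·A'` is a prime of height one
in every localization `A'` of `A` at a submonoid `M` with `e ∈ M ⊆ A ∖ 𝔮₀`. (Finite generation of `𝔭 = x·A_{𝔮₀} ∩ A`,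
clearing the finitely many denominators; Krull's principal ideal theorem.) [cite: Matsumura1987, Thm. 4.1, Thm. 13.5] [folklore] -/
theorem exists_away_span_singleton_isPrime_of_isLocalization (𝔮₀ : Ideal A) [𝔮₀.IsPrime] {x : A} (hx0 : x ≠ 0)
    (hx : (Ideal.span {algebraMap A (Localization.AtPrime 𝔮₀) x}).IsPrime) :
    ∃ e : A, e ∉ 𝔮₀ ∧
      ∀ (M : Submonoid A), e ∈ M → M ≤ 𝔮₀.primeCompl →
        ∀ (A' : Type v) [CommRing A'] [Algebra A A'] [IsLocalization M A'],
          (Ideal.span {algebraMap A A' x}).IsPrime ∧ (Ideal.span {algebraMap A A' x}).height = 1 := by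
  classical
  set S := Localization.AtPrime 𝔮₀ with hS
  -- the contracted prime `𝔭 = x·A_{𝔮₀} ∩ A`
  set 𝔭 : Ideal A := Ideal.comap (algebraMap A S) (Ideal.span {algebraMap A S x}) with h𝔭
  haveI h𝔭prime : 𝔭.IsPrime := Ideal.IsPrime.comap (algebraMap A S)
  have hx𝔭 : x ∈ 𝔭 := Ideal.mem_comap.mpr (Ideal.mem_span_singleton_self _)
  have h𝔭𝔮₀ : 𝔭 ≤ 𝔮₀ := by
    have hle : Ideal.span {algebraMap A S x} ≤ IsLocalRing.maximalIdeal S :=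
      IsLocalRing.le_maximalIdeal hx.ne_top
    intro a ha
    have ha' : algebraMap A S a ∈ IsLocalRing.maximalIdeal S := hle (Ideal.mem_comap.mp ha)
    exact (IsLocalization.AtPrime.to_map_mem_maximal_iff S 𝔮₀ a).mp ha'
  -- `x·S` is the extension of `x·A`
  have hmapx : Ideal.map (algebraMap A S) (Ideal.span {x}) = Ideal.span {algebraMap A S x} := by
    rw [Ideal.map_span, Set.image_singleton]
  -- finite generation of `𝔭` and the denominators
  obtain ⟨G, hG⟩ := (IsNoetherian.noetherian 𝔭 : 𝔭.FG)
  have hden : ∀ g ∈ G, ∃ m : A, m ∈ 𝔮₀.primeCompl ∧ m * g ∈ Ideal.span {x} := by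
    intro g hg
    have hg𝔭 : g ∈ 𝔭 := hG ▸ Ideal.subset_span hg
    have hgS : algebraMap A S g ∈ Ideal.map (algebraMap A S) (Ideal.span {x}) := by
      rw [hmapx]; exact Ideal.mem_comap.mp hg𝔭
    exact (IsLocalization.algebraMap_mem_map_algebraMap_iff 𝔮₀.primeCompl S _ _).mp hgS
  choose! m hm using hden
  refine ⟨∏ g ∈ G, m g, ?_, ?_⟩
  · -- `e = ∏ m_g ∉ 𝔮₀`
    have hmem : (∏ g ∈ G, m g) ∈ 𝔮₀.primeCompl :=
      Submonoid.prod_mem _ fun g hg => (hm g hg).1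
    exact hmem
  intro M heM hM A' _ _ _
  -- every denominator is a unit of `A'`
  have hunit : ∀ g ∈ G, IsUnit (algebraMap A A' (m g)) := by
    intro g hg
    have he : IsUnit (algebraMap A A' (∏ g' ∈ G, m g')) := IsLocalization.map_units A' ⟨_, heM⟩
    rw [← Finset.mul_prod_erase G m hg, map_mul] at he
    exact isUnit_of_mul_isUnit_left he
  -- `𝔭·A' = x·A'`
  have hmap𝔭 : Ideal.map (algebraMap A A') 𝔭 = Ideal.span {algebraMap A A' x} := by
    apply le_antisymm
    · rw [← hG, Ideal.map_span, Ideal.span_le]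
      rintro _ ⟨g, hg, rfl⟩
      obtain ⟨u, hu⟩ := hunit g hg
      have hmg : algebraMap A A' (m g * g) ∈ Ideal.span {algebraMap A A' x} := by
        have h1 : algebraMap A A' (m g * g) ∈ Ideal.map (algebraMap A A') (Ideal.span {x}) :=
          Ideal.mem_map_of_mem _ (hm g hg).2
        rwa [Ideal.map_span, Set.image_singleton] at h1
      rw [map_mul, ← hu] at hmg
      have h2 := Ideal.mul_mem_left _ (↑u⁻¹ : A') hmg
      rwa [← mul_assoc, Units.inv_mul, one_mul] at h2
    · rw [Ideal.span_le, Set.singleton_subset_iff]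
      exact Ideal.mem_map_of_mem _ hx𝔭
  -- primality
  have hdisj : Disjoint (M : Set A) (𝔭 : Set A) :=
    Set.disjoint_left.mpr fun a ha ha' => hM ha (h𝔭𝔮₀ ha')
  have hprime : (Ideal.span {algebraMap A A' x}).IsPrime := by
    rw [← hmap𝔭]
    exact IsLocalization.isPrime_of_isPrime_disjoint M A' 𝔭 h𝔭prime hdisj
  refine ⟨hprime, ?_⟩
  -- height one (Krull): `A'` is a Noetherian domain, `x ≠ 0` a non-unit there
  haveI : IsNoetherianRing A' := IsLocalization.isNoetherianRing M A' inferInstance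
  have hM0 : M ≤ nonZeroDivisors A := by
    refine le_nonZeroDivisors_of_noZeroDivisors fun h0 => ?_
    exact hM h0 (Ideal.zero_mem 𝔮₀)
  haveI : IsDomain A' := IsLocalization.isDomain_of_le_nonZeroDivisors A' hM0
  have hx0' : algebraMap A A' x ≠ 0 := by
    intro h
    exact hx0 ((IsLocalization.injective A' hM0) (by rw [h, map_zero]))
  exact Ideal.height_span_singleton_eq_one_of_mem_nonZeroDivisors
    (mem_nonZeroDivisors_of_ne_zero hx0') (fun hu => hprime.ne_top (Ideal.span_singleton_eq_top.mpr hu))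

/-- **(S1c) of S1-SPEC: shrinking the chart by a basic open.** `A` a Noetherian domain, `x ≠ 0`, `𝔮₀` prime with `x·A_{𝔮₀}`
prime ⇒ `∃ e ∉ 𝔮₀` with `x·A[1/e]` a prime ideal of height one. [cite: Matsumura1987, Thm. 4.1, Thm. 13.5] [folklore] -/
theorem exists_away_span_singleton_isPrime (𝔮₀ : Ideal A) [𝔮₀.IsPrime] {x : A} (hx0 : x ≠ 0)
    (hx : (Ideal.span {algebraMap A (Localization.AtPrime 𝔮₀) x}).IsPrime) :
    ∃ e : A, e ∉ 𝔮₀ ∧ (Ideal.span {algebraMap A (Localization.Away e) x}).IsPrime ∧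
      (Ideal.span {algebraMap A (Localization.Away e) x}).height = 1 := by
  obtain ⟨e, he, h⟩ := exists_away_span_singleton_isPrime_of_isLocalization.{u, u} 𝔮₀ hx0 hx
  refine ⟨e, he, h (Submonoid.powers e) (Submonoid.mem_powers e) ?_ (Localization.Away e)⟩
  exact (Submonoid.powers_le).mpr he

end Summit.ResolutionOfSingularities.ResolutionOfSingularities.Theorems.RadicialJung.CleanModels

end
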